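import Summits.BirchSwinnertonDyer.BirchSwinnertonDyer.Theorems.ErratumRoadFiveIMCDivCongruenceCoefficientDescent
import Summits.BirchSwinnertonDyer.BirchSwinnertonDyer.Theorems.ErratumRoadFiveIMCDivOneSidedCongruenceLe
import HarnessLib

/-!
# Route `ErratumRoadFive`, crux `IMCDivAtErratumDataAll` (item stmt-BirchSwinnertonDyer-19270): the
# one-sided congruence limit WITH VARYING COEFFICIENT RINGS AND (c) ONE-SIDED, and the coefficient-honest
# erratum transfer on `X_ac^Σ(E[p^∞])` at the FITTING level (no Lemma 2.2)

Cell `bsd-stepL` (run/shared/lean/pub/bsd-stepL/), seat `bsd-stepL-imc-p1` (prover, session g8);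
`--supports stmt-BirchSwinnertonDyer-19270 --as helper`. THEOREMS ONLY (pure commutative algebra + two
instances on the constructed module `AcSelmer.XAc`); no definition, no named fact, no `sorry`; nothing is
asserted about any curve; the item is NOT closed by this.

## Why

The Road FF members `g_m ≡ f (mod p^m)` carry their OWN coefficient rings `𝒪_m ⊋ ℤ_p` (flagged on the
cell bus 2026-08-27 02:02Z ∕ 02:04Z). The tree holds two erratum transfers on `X^Σ = X_ac^Σ(E[p^∞])`:

* imc24c's `AcSelmer.XAc.charIdeal_map_toUnr_le_span_of_oneSided_congruences_descent`
  (`Theorems/ErratumRoadFiveIMCDivCongruenceCoefficientDescent.lean`): members over per-`m` coefficient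
  squares `Λ → R'_m → S'_m ← R₀⟦T⟧` (faithfully flat descent — honest coefficients), but with the congruence
  (c) as the two-sided EQUALITY `(L_m) + (p^m) = (L^Σ) + (p^m)` and WITH erratum Lemma 2.2 (`X^Σ` has no
  nonzero finite submodule);
* imc24b's `AcSelmer.XAc.charIdeal_map_toUnr_le_span_of_oneSided_congruences_le`
  (`Theorems/ErratumRoadFiveIMCDivOneSidedCongruenceLe.lean`, the package of record p482642): (c) as the
  printed-usable INCLUSION `(L_m) ⊆ (L^Σ) + (p^m)`, NO Lemma 2.2 (it stops at `Fitt₀(X^Σ)` and removes `Σ`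
  by two-prime cancellation), but members over the SINGLE ring `Λ` (`d = [𝒪_m : ℤ_p] = 1` only).

This file proves the common refinement both roads need:

* §1 **`CongruenceDescent.map_fittingIdeal_le_sup_of_congruence_descent_le`** ∕
  **`CongruenceDescent.map_le_span_of_oneSided_congruences_descent_le`** — imc24c's per-`m` descent step
  and Krull limit with the congruence hypothesis weakened to the inclusion
  `(L_m) ⊆ (L·1_{S'_m}) + I^m S'_m` (imc24c's equality implies it). Same ingredients: Fitting ideals
  commute with base change (`Module.fittingIdeal_baseChange`, Stacks 07ZA (3)), Fitting ideals modulo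
  `I^m` along the member isomorphism (`CongruenceLimit.fittingIdeal_sup_eq_of_quotEquiv`), contraction
  `(𝔞S') ∩ S = 𝔞` for faithfully flat `S → S'` (`Ideal.comap_map_eq_self_of_faithfullyFlat`), Krull
  (`CongruenceLimit.iInf_sup_pow_eq_self`).
* §2 ON `X^Σ`: **`AcSelmer.XAc.map_fittingIdeal_le_span_of_oneSided_congruences_descent_le`** — members
  over per-`m` coefficient squares, one-sided (c) in `S'_m` ⟹ `Fitt₀_Λ(X^Σ)·R₀⟦T⟧ ⊆ (L^Σ)` (needs only
  `Σ` finite); its PRINTED-shape variant `…_descent_le_printed` taking (2.5)_m as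
  "`N_m` torsion → `Ch_{R'_m}(N_m)·S'_m ⊆ (L_m)`" over Noetherian UFDs `R'_m = 𝒪_m⟦T⟧`; and the full
  coefficient-honest, Lemma-2.2-free, one-sided erratum transfer
  **`AcSelmer.XAc.charIdeal_map_toUnr_le_span_of_oneSided_congruences_descent_le`**: add `X^Σ` torsion
  [CTL], `P_Σ ≠ 0`, `Ch(X^∅)·(P_Σ) ⊆ Ch(X^Σ)`, `L·φ(P_Σ) ∣ L^Σ` [Cas18 (3.1)] ⟹ `Ch_Λ(X^∅)·R₀⟦T⟧ ⊆ (L)`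
  (imc24b's `…_of_map_fittingIdeal_le` after §2's Fitting-level limit).

So the Road FF input cut can be made COEFFICIENT-FREE at the datum level: the member data enter only the
PROOF of the single Fitting-level statement `Fitt₀_Λ(X^Σ).map toUnr ≤ span {L^Σ}`, in `Λ ∕ R₀⟦T⟧`
currency, whatever the `𝒪_m`.

References: [Skinner2016PacificMC] §2.6, §3.1 (p. 192); [Castella2018Erratum] (b), (c), Lemma 2.1, (2.5),
proof of Thm. 1.1 (p. 4); [Castella2018] (3.1), (4.1) (arXiv:1704.06608 pp. 9, 11); [StacksProject] 07ZA (3),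
05GI; [FouquetWan2021] Thm. 4.41 (shape of (2.5)_m only).
-/

set_option autoImplicit false

noncomputable section

open scoped Classical TensorProduct

open PowerSeries Literature.NumberTheory.EllipticCurves Literature.NumberTheory.EllipticCurves.Module
  Literature.RingTheory.FittingIdeal NumberField IsDedekindDomain Field
open Summit.BirchSwinnertonDyer.Rank1Residual.X11b.AcSelmer Summit.BirchSwinnertonDyer.Rank1Residual.X11b.Halves
  Summit.BirchSwinnertonDyer.Rank1Residual.X2

namespace Summit.BirchSwinnertonDyer.Rank1Residual.X11b

/-! ### §1 The one-sided congruence limit across `φ : R → S`, per-member coefficient rings, (c) one-sided -/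

namespace CongruenceDescent

universe u v w

variable {R : Type*} [CommRing R] {S : Type u} [CommRing S] (φ : R →+* S) (I : Ideal R)
  {M : Type*} [AddCommGroup M] [Module R M] [Module.Finite R M]

/-- **One congruence step with its own coefficients and (c) ONE-SIDED, contracted to `S`.** Data: a
commutative square `R → R' →(φ') S' ← S` (`φ' ∘ (R → R') = (S → S') ∘ φ`) with `S'` FAITHFULLY FLAT over
`S`, a finite `R'`-module `N` (`X^Σ_ac(A_{g_m})` over `Λ_{𝒪_m}`), an `R'`-isomorphism `(R' ⊗_R M)/I^m ≅ N/I^m`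
[(b) + Lemma 2.1 over `𝒪_m`], the member inclusion `Fitt_{R'}(N)·S' ⊆ (L_m)` [(2.5)_m] and the ONE-SIDED
congruence `(L_m) ⊆ (L·1_{S'}) + I^m S'` [(c), Cas18 (4.1) + `ν_{g_m} ≡ ν_f`] in `S'`. Then, IN `S`:
`Fitt_R(M)·S ⊆ (L) + I^m S`. Proof: `Fitt_{R'}(R' ⊗ M) = Fitt_R(M)·R'` (Stacks 07ZA (3)); Fitting ideals
modulo `I^m` along the isomorphism; push to `S'`; contract to `S` by `(𝔞S') ∩ S = 𝔞` (faithful flatness).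
imc24c's `map_fittingIdeal_sup_le_of_congruence_descent` is the case where (c) is an equality.
[cite: Skinner2016PacificMC, §2.6 and §3.1 (p. 192) ("replacing `L` by a finite extension")]
[cite: Castella2018Erratum, proof of Thm. 1.1 (p. 4), read one-sidedly] [cite: StacksProject, Tag 07ZA (3)] -/
theorem map_fittingIdeal_le_sup_of_congruence_descent_le
    (R' : Type v) [CommRing R'] [Algebra R R'] (S' : Type w) [CommRing S'] [Algebra S S']
    [Module.FaithfullyFlat S S'] (φ' : R' →+* S')
    (hφ' : φ'.comp (algebraMap R R') = (algebraMap S S').comp φ)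
    (N : Type*) [AddCommGroup N] [Module R' N] [Module.Finite R' N] {L : S} {Lm : S'} {m : ℕ}
    (e : ((R' ⊗[R] M) ⧸ ((I.map (algebraMap R R')) ^ m • (⊤ : Submodule R' (R' ⊗[R] M)))) ≃ₗ[R']
      (N ⧸ ((I.map (algebraMap R R')) ^ m • (⊤ : Submodule R' N))))
    (hF : (Module.fittingIdeal R' N 0).map φ' ≤ Ideal.span {Lm})
    (hc : Ideal.span {Lm} ≤
      Ideal.span {algebraMap S S' L} ⊔ ((I.map φ).map (algebraMap S S')) ^ m) :
    (Module.fittingIdeal R M 0).map φ ≤ Ideal.span {L} ⊔ (I.map φ) ^ m := by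
  -- adapted from imc24c's `map_fittingIdeal_sup_le_of_congruence_descent` (same file family), (c) one-sided
  set ψ : S →+* S' := algebraMap S S' with hψ
  -- the two composite maps `R → S'` agree
  have hcomp : ψ.comp φ = φ'.comp (algebraMap R R') := by rw [hψ, hφ']
  -- images in `S'` of the three ideals
  have hA : ((Module.fittingIdeal R M 0).map φ).map ψ =
      (Module.fittingIdeal R' (R' ⊗[R] M) 0).map φ' := by
    rw [Ideal.map_map, hcomp, ← Ideal.map_map, Module.fittingIdeal_baseChange]
  have hB : ((I.map φ) ^ m).map ψ = ((I.map (algebraMap R R')) ^ m).map φ' := by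
    rw [Ideal.map_pow, Ideal.map_pow, Ideal.map_map, Ideal.map_map, hcomp]
  have hB' : ((I.map φ).map ψ) ^ m = ((I.map (algebraMap R R')) ^ m).map φ' := by
    rw [← Ideal.map_pow, hB]
  have hC : (Ideal.span {L}).map ψ = Ideal.span {ψ L} := by
    rw [Ideal.map_span, Set.image_singleton]
  -- the one-sided congruence step over `R'`, pushed to `S'`
  have hstep : (Module.fittingIdeal R' (R' ⊗[R] M) 0).map φ' ≤
      Ideal.span {Lm} ⊔ ((I.map (algebraMap R R')) ^ m).map φ' := by
    have h1 : (Module.fittingIdeal R' (R' ⊗[R] M) 0).map φ' ≤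
        (Module.fittingIdeal R' (R' ⊗[R] M) 0 ⊔ (I.map (algebraMap R R')) ^ m).map φ' :=
      Ideal.map_mono le_sup_left
    rw [CongruenceLimit.fittingIdeal_sup_eq_of_quotEquiv ((I.map (algebraMap R R')) ^ m) e 0,
      Ideal.map_sup] at h1
    exact h1.trans (sup_le_sup_right hF _)
  -- hence the inclusion of the images in `S'`
  have himg : ((Module.fittingIdeal R M 0).map φ).map ψ ≤ (Ideal.span {L} ⊔ (I.map φ) ^ m).map ψ := by
    rw [Ideal.map_sup, hA, hB, hC]
    refine hstep.trans (sup_le ?_ le_sup_right)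
    rw [← hB']
    exact hc
  -- contract to `S` (faithful flatness)
  have h := Ideal.comap_mono (f := ψ) himg
  rwa [hψ, Ideal.comap_map_eq_self_of_faithfullyFlat,
    Ideal.comap_map_eq_self_of_faithfullyFlat] at h

/-- **The one-sided congruence limit with per-member coefficient rings and (c) ONE-SIDED** — [Ski16, §3.1
(p. 192)] ∕ erratum p. 4 read one-sidedly, "replacing `L` by a finite extension" made explicit. `S`
Noetherian with `φ(I) ⊆ Jac(S)`; `J ⊆ Fitt_R(M)`; for every `m ≥ 1` a coefficient square
`R → R'_m →(φ'_m) S'_m ← S` with `S'_m` faithfully flat over `S`, a finite `R'_m`-module `N_m`, an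
`R'_m`-isomorphism `(R'_m ⊗_R M)/I^m ≅ N_m/I^m`, `Fitt_{R'_m}(N_m)·S'_m ⊆ (L_m)` and the INCLUSION
`(L_m) ⊆ (L) + I^m S'_m` in `S'_m`. Then `J·S ⊆ ⋂_m ((L) + I^m S) = (L)` (Krull). No torsion-ness or
finite-submodule hypothesis; no `L ≠ 0`. imc24c's `map_le_span_of_oneSided_congruences_descent` is the case
where every (c) is an equality; imc24b's `map_le_span_of_oneSided_congruences_le` the case `R'_m = R`,
`S'_m = S`. [cite: Skinner2016PacificMC, §3.1 (p. 192)]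
[cite: Castella2018Erratum, proof of Thm. 1.1 (p. 4), read one-sidedly]
[cite: StacksProject, Tag 05GI (Krull's intersection theorem)] -/
theorem map_le_span_of_oneSided_congruences_descent_le [IsNoetherianRing S]
    (hI : I.map φ ≤ (⊥ : Ideal S).jacobson) {J : Ideal R} (hJ : J ≤ Module.fittingIdeal R M 0)
    (L : S) (R' : ℕ → Type v) [∀ m, CommRing (R' m)] [∀ m, Algebra R (R' m)]
    (S' : ℕ → Type w) [∀ m, CommRing (S' m)] [∀ m, Algebra S (S' m)]
    [∀ m, Module.FaithfullyFlat S (S' m)] (φ' : ∀ m, R' m →+* S' m)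
    (hφ' : ∀ m, (φ' m).comp (algebraMap R (R' m)) = (algebraMap S (S' m)).comp φ)
    (N : ℕ → Type*) [∀ m, AddCommGroup (N m)] [∀ m, Module (R' m) (N m)]
    [∀ m, Module.Finite (R' m) (N m)] (Lm : ∀ m, S' m)
    (e : ∀ m : ℕ, 1 ≤ m →
      (((R' m ⊗[R] M) ⧸ ((I.map (algebraMap R (R' m))) ^ m •
          (⊤ : Submodule (R' m) (R' m ⊗[R] M)))) ≃ₗ[R' m]
        (N m ⧸ ((I.map (algebraMap R (R' m))) ^ m • (⊤ : Submodule (R' m) (N m))))))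
    (hF : ∀ m : ℕ, 1 ≤ m → (Module.fittingIdeal (R' m) (N m) 0).map (φ' m) ≤ Ideal.span {Lm m})
    (hc : ∀ m : ℕ, 1 ≤ m →
      Ideal.span {Lm m} ≤
        Ideal.span {algebraMap S (S' m) L} ⊔ ((I.map φ).map (algebraMap S (S' m))) ^ m) :
    J.map φ ≤ Ideal.span {L} := by
  refine (Ideal.map_mono hJ).trans ?_
  rw [← CongruenceLimit.iInf_sup_pow_eq_self (I.map φ) (Ideal.span {L}) hI]
  refine le_iInf fun m ↦ ?_
  rcases Nat.eq_zero_or_pos m with rfl | hm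
  · rw [pow_zero, Ideal.one_eq_top, sup_top_eq]; exact le_top
  · exact le_sup_left.trans (sup_le
      (map_fittingIdeal_le_sup_of_congruence_descent_le φ I (R' m) (S' m) (φ' m) (hφ' m) (N m)
        (e m hm) (hF m hm) (hc m hm)) le_sup_right)

end CongruenceDescent

/-! ### §2 On the tree object `X_ac^Σ(E[p^∞])`: `Λ → R₀⟦T⟧`, per-member coefficients, (c) one-sided -/

section XAc

variable {K : Type} [Field K] [NumberField K] (E : WeierstrassCurve K) [E.IsElliptic]
  (p : ℕ) [Fact p.Prime] (κ : ZpExtension K p) (𝔭 : HeightOneSpectrum (𝓞 K))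
  {S : Set (HeightOneSpectrum (𝓞 K))} (γ : Field.absoluteGaloisGroup K) [Fact (κ.IsTopGenerator γ)]

universe v w

/-- **The member limit ON `X^Σ = X_ac^Σ(E[p^∞])` at the FITTING level, members with their OWN
coefficient rings, (c) ONE-SIDED.** `Σ` finite (so `X^Σ` is finitely generated); for each `m ≥ 1` a
coefficient square `Λ → R'_m →(φ'_m) S'_m ← R₀⟦T⟧` (`R'_m = Λ_{𝒪_m}`, `S'_m = Λ^{ur}_{𝒪_m}`; `S'_m`
faithfully flat over `R₀⟦T⟧` — finite free in the application), a finite `R'_m`-module `N_m`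
(`X^Σ_ac(A_{g_m})`) with an `R'_m`-isomorphism `(R'_m ⊗_Λ X^Σ)/p^m ≅ N_m/p^m` [(b) + Lemma 2.1, dualised],
`Fitt_{R'_m}(N_m)·S'_m ⊆ (L_m)` [⟸ PRINTED (2.5)_m] and `(L_m) ⊆ (L^Σ) + (p^m)` in `S'_m` [(c)]. THEN
`Fitt₀_Λ(X^Σ)·R₀⟦T⟧ ⊆ (L^Σ)` — the single coefficient-free statement the Road FF members feed. No torsion,
no Lemma 2.2. Pure algebra on the constructed module; CONDITIONAL on the displayed inputs.
[cite: Castella2018Erratum, Lemma 2.1 and proof of Thm. 1.1 (p. 4), read one-sidedly]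
[cite: Skinner2016PacificMC, §2.6, §3.1 (p. 192)] -/
theorem AcSelmer.XAc.map_fittingIdeal_le_span_of_oneSided_congruences_descent_le (hS : S.Finite)
    (LS : UnrSeries p) (R' : ℕ → Type v) [∀ m, CommRing (R' m)]
    [∀ m, Algebra (IwasawaAlgebra p) (R' m)]
    (S' : ℕ → Type w) [∀ m, CommRing (S' m)] [∀ m, Algebra (UnrSeries p) (S' m)]
    [∀ m, Module.FaithfullyFlat (UnrSeries p) (S' m)] (φ' : ∀ m, R' m →+* S' m)
    (hφ' : ∀ m, (φ' m).comp (algebraMap (IwasawaAlgebra p) (R' m)) =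
      (algebraMap (UnrSeries p) (S' m)).comp (PowerSeries.map (toUnr p)))
    (N : ℕ → Type) [∀ m, AddCommGroup (N m)] [∀ m, Module (R' m) (N m)]
    [∀ m, Module.Finite (R' m) (N m)] (Lm : ∀ m, S' m)
    (e : ∀ m : ℕ, 1 ≤ m →
      (((R' m ⊗[IwasawaAlgebra p] XAc E p κ 𝔭 S γ) ⧸
          (((Ideal.span {(PowerSeries.C (p : ℤ_[p]) : IwasawaAlgebra p)}).map
              (algebraMap (IwasawaAlgebra p) (R' m))) ^ m •
            (⊤ : Submodule (R' m) (R' m ⊗[IwasawaAlgebra p] XAc E p κ 𝔭 S γ)))) ≃ₗ[R' m]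
        (N m ⧸ (((Ideal.span {(PowerSeries.C (p : ℤ_[p]) : IwasawaAlgebra p)}).map
            (algebraMap (IwasawaAlgebra p) (R' m))) ^ m • (⊤ : Submodule (R' m) (N m))))))
    (hF : ∀ m : ℕ, 1 ≤ m → (Module.fittingIdeal (R' m) (N m) 0).map (φ' m) ≤ Ideal.span {Lm m})
    (hc : ∀ m : ℕ, 1 ≤ m →
      Ideal.span {Lm m} ≤
        Ideal.span {algebraMap (UnrSeries p) (S' m) LS} ⊔
          (((Ideal.span {(PowerSeries.C (p : ℤ_[p]) : IwasawaAlgebra p)}).map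
              (PowerSeries.map (toUnr p))).map (algebraMap (UnrSeries p) (S' m))) ^ m) :
    (Module.fittingIdeal (IwasawaAlgebra p) (XAc E p κ 𝔭 S γ) 0).map (PowerSeries.map (toUnr p)) ≤
      Ideal.span {LS} := by
  haveI : Module.Finite (IwasawaAlgebra p) (XAc E p κ 𝔭 S γ) := XAc.module_finite κ 𝔭 S γ hS
  haveI := HidaLimitAlgebra.isNoetherianRing_unrSeries (p := p)
  have hI : (Ideal.span {(PowerSeries.C (p : ℤ_[p]) : IwasawaAlgebra p)}).map
      (PowerSeries.map (toUnr p)) ≤ (⊥ : Ideal (UnrSeries p)).jacobson := by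
    rw [HidaLimitAlgebra.map_span_C_p]
    exact HidaLimitAlgebra.span_C_p_le_jacobson_unrSeries
  exact CongruenceDescent.map_le_span_of_oneSided_congruences_descent_le
    (PowerSeries.map (toUnr p)) (Ideal.span {(PowerSeries.C (p : ℤ_[p]) : IwasawaAlgebra p)}) hI
    (le_refl (Module.fittingIdeal (IwasawaAlgebra p) (XAc E p κ 𝔭 S γ) 0)) LS R' S' φ' hφ' N Lm e hF hc

/-- **The same member limit with (2.5)_m in its PRINTED shape** — "`N_m` torsion → `Ch_{R'_m}(N_m)·S'_m ⊆
(L_m)`" over Noetherian UFDs `R'_m` (`= 𝒪_m⟦T⟧`), converted to the Fitting-level member inclusion by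
imc24c's `CongruenceDescent.map_fittingIdeal_le_of_printed_charIdeal_le` (`Fitt₀ ⊆ Ch` for torsion
modules, `Fitt₀ = 0` otherwise). Output: `Fitt₀_Λ(X^Σ)·R₀⟦T⟧ ⊆ (L^Σ)`. CONDITIONAL on the inputs.
[cite: Castella2018Erratum, (2.5) and proof of Thm. 1.1 (p. 4), read one-sidedly]
[cite: FouquetWan2021, Thm. 4.41 (shape of the conclusion)] -/
theorem AcSelmer.XAc.map_fittingIdeal_le_span_of_oneSided_congruences_descent_le_printed
    (hS : S.Finite) (LS : UnrSeries p) (R' : ℕ → Type v) [∀ m, CommRing (R' m)]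
    [∀ m, IsNoetherianRing (R' m)] [∀ m, IsDomain (R' m)] [∀ m, UniqueFactorizationMonoid (R' m)]
    [∀ m, Algebra (IwasawaAlgebra p) (R' m)]
    (S' : ℕ → Type w) [∀ m, CommRing (S' m)] [∀ m, Algebra (UnrSeries p) (S' m)]
    [∀ m, Module.FaithfullyFlat (UnrSeries p) (S' m)] (φ' : ∀ m, R' m →+* S' m)
    (hφ' : ∀ m, (φ' m).comp (algebraMap (IwasawaAlgebra p) (R' m)) =
      (algebraMap (UnrSeries p) (S' m)).comp (PowerSeries.map (toUnr p)))
    (N : ℕ → Type) [∀ m, AddCommGroup (N m)] [∀ m, Module (R' m) (N m)]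
    [∀ m, Module.Finite (R' m) (N m)] (Lm : ∀ m, S' m)
    (e : ∀ m : ℕ, 1 ≤ m →
      (((R' m ⊗[IwasawaAlgebra p] XAc E p κ 𝔭 S γ) ⧸
          (((Ideal.span {(PowerSeries.C (p : ℤ_[p]) : IwasawaAlgebra p)}).map
              (algebraMap (IwasawaAlgebra p) (R' m))) ^ m •
            (⊤ : Submodule (R' m) (R' m ⊗[IwasawaAlgebra p] XAc E p κ 𝔭 S γ)))) ≃ₗ[R' m]
        (N m ⧸ (((Ideal.span {(PowerSeries.C (p : ℤ_[p]) : IwasawaAlgebra p)}).map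
            (algebraMap (IwasawaAlgebra p) (R' m))) ^ m • (⊤ : Submodule (R' m) (N m))))))
    (hCh : ∀ m : ℕ, 1 ≤ m → Module.IsTorsion (R' m) (N m) →
      (Module.charIdeal (R' m) (N m)).map (φ' m) ≤ Ideal.span {Lm m})
    (hc : ∀ m : ℕ, 1 ≤ m →
      Ideal.span {Lm m} ≤
        Ideal.span {algebraMap (UnrSeries p) (S' m) LS} ⊔
          (((Ideal.span {(PowerSeries.C (p : ℤ_[p]) : IwasawaAlgebra p)}).map
              (PowerSeries.map (toUnr p))).map (algebraMap (UnrSeries p) (S' m))) ^ m) :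
    (Module.fittingIdeal (IwasawaAlgebra p) (XAc E p κ 𝔭 S γ) 0).map (PowerSeries.map (toUnr p)) ≤
      Ideal.span {LS} :=
  AcSelmer.XAc.map_fittingIdeal_le_span_of_oneSided_congruences_descent_le E p κ 𝔭 γ hS LS R' S' φ'
    hφ' N Lm e
    (fun m hm ↦ CongruenceDescent.map_fittingIdeal_le_of_printed_charIdeal_le (φ' m) (hCh m hm)) hc

/-- **Erratum p. 4 ∕ [Ski16, p. 192] read ONE-SIDEDLY on `X^Σ = X_ac^Σ(E[p^∞])`, members with their
OWN coefficient rings, (c) AND the `Σ`-identity ONE-SIDED, NO Lemma 2.2** — the coefficient-honest form of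
imc24b's `AcSelmer.XAc.charIdeal_map_toUnr_le_span_of_oneSided_congruences_le`: `Σ` finite, `X^Σ`
`Λ`-torsion [CTL]; members `N_m` over coefficient squares `Λ → R'_m → S'_m ← R₀⟦T⟧` (`S'_m` faithfully
flat) with `(R'_m ⊗_Λ X^Σ)/p^m ≅ N_m/p^m` [(b) + Lemma 2.1], `Fitt_{R'_m}(N_m)·S'_m ⊆ (L_m)` [(2.5)_m,
FW21 4.41 at `p ∥ N`, PREPRINT], `(L_m) ⊆ (L^Σ) + (p^m)` in `S'_m` [(c)]; `P_Σ ≠ 0`,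
`Ch(X^∅)·(P_Σ) ⊆ Ch(X^Σ)`, `L·φ(P_Σ) ∣ L^Σ` [Cas18 (3.1)]. Output: `Ch_Λ(X^∅)·R₀⟦T⟧ ⊆ (L)`.
§2's Fitting-level limit followed by imc24b's `…_of_map_fittingIdeal_le` (torsion bounds, `Σ`-removal,
two-prime cancellation in the UFD `R₀⟦T⟧`). CONDITIONAL on the displayed inputs; nothing asserted about
the curve. [cite: Castella2018Erratum, proof of Thm. 1.1 (p. 4), read one-sidedly]
[cite: Skinner2016PacificMC, §2.6, §3.1 (p. 192)] [cite: Castella2018, (3.1), (4.1) (arXiv:1704.06608 pp. 9, 11)] -/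
theorem AcSelmer.XAc.charIdeal_map_toUnr_le_span_of_oneSided_congruences_descent_le (hS : S.Finite)
    (hT : Module.IsTorsion (IwasawaAlgebra p) (XAc E p κ 𝔭 S γ))
    (LS : UnrSeries p) (R' : ℕ → Type v) [∀ m, CommRing (R' m)]
    [∀ m, Algebra (IwasawaAlgebra p) (R' m)]
    (S' : ℕ → Type w) [∀ m, CommRing (S' m)] [∀ m, Algebra (UnrSeries p) (S' m)]
    [∀ m, Module.FaithfullyFlat (UnrSeries p) (S' m)] (φ' : ∀ m, R' m →+* S' m)
    (hφ' : ∀ m, (φ' m).comp (algebraMap (IwasawaAlgebra p) (R' m)) =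
      (algebraMap (UnrSeries p) (S' m)).comp (PowerSeries.map (toUnr p)))
    (N : ℕ → Type) [∀ m, AddCommGroup (N m)] [∀ m, Module (R' m) (N m)]
    [∀ m, Module.Finite (R' m) (N m)] (Lm : ∀ m, S' m)
    (e : ∀ m : ℕ, 1 ≤ m →
      (((R' m ⊗[IwasawaAlgebra p] XAc E p κ 𝔭 S γ) ⧸
          (((Ideal.span {(PowerSeries.C (p : ℤ_[p]) : IwasawaAlgebra p)}).map
              (algebraMap (IwasawaAlgebra p) (R' m))) ^ m •
            (⊤ : Submodule (R' m) (R' m ⊗[IwasawaAlgebra p] XAc E p κ 𝔭 S γ)))) ≃ₗ[R' m]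
        (N m ⧸ (((Ideal.span {(PowerSeries.C (p : ℤ_[p]) : IwasawaAlgebra p)}).map
            (algebraMap (IwasawaAlgebra p) (R' m))) ^ m • (⊤ : Submodule (R' m) (N m))))))
    (hF : ∀ m : ℕ, 1 ≤ m → (Module.fittingIdeal (R' m) (N m) 0).map (φ' m) ≤ Ideal.span {Lm m})
    (hc : ∀ m : ℕ, 1 ≤ m →
      Ideal.span {Lm m} ≤
        Ideal.span {algebraMap (UnrSeries p) (S' m) LS} ⊔
          (((Ideal.span {(PowerSeries.C (p : ℤ_[p]) : IwasawaAlgebra p)}).map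
              (PowerSeries.map (toUnr p))).map (algebraMap (UnrSeries p) (S' m))) ^ m)
    {PS : IwasawaAlgebra p} (hPS : PS ≠ 0)
    (hX : XAc.charIdeal E p κ 𝔭 ∅ γ * Ideal.span {PS} ≤ XAc.charIdeal E p κ 𝔭 S γ)
    {L : UnrSeries p} (hLS : L * PowerSeries.map (toUnr p) PS ∣ LS) :
    (XAc.charIdeal E p κ 𝔭 ∅ γ).map (PowerSeries.map (toUnr p)) ≤ Ideal.span {L} :=
  AcSelmer.XAc.charIdeal_map_toUnr_le_span_of_map_fittingIdeal_le E p κ 𝔭 γ hS hT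
    (AcSelmer.XAc.map_fittingIdeal_le_span_of_oneSided_congruences_descent_le E p κ 𝔭 γ hS LS R' S'
      φ' hφ' N Lm e hF hc) hPS hX hLS

end XAc

end Summit.BirchSwinnertonDyer.Rank1Residual.X11b

end
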